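import Mathlib
import HarnessLib
import Summits.Langlands.Langlands.Theses.BaseFieldAscent
import Summits.Langlands.Langlands.Theorems.BaseFieldAscentReciprocityTRCMOfDescent

/-!
# Line `pieces` (= payload line `registered`) — skeleton v8 for crux stmt-Langlands-1093
`Summit.Langlands.Langlands.Theses.BaseFieldAscent.ReciprocityTRCM` (route-Langlands-BaseFieldAscent)

Crux-strategist decomposition (EXEMPT-46 redirect re-exam, 2026-08-17). The crux — the summit body
restricted to totally real and CM base fields, `∃ 𝓡`-shape — is split at ROUTE level into three pieces
(the three stubs of the registered birth skeleton `Lines/birth.lean`, promoted to items):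

* `X₁ = AutToGalCM` — direction (A) over CM fields (VERBATIM item stmt-Langlands-1059; its own plan is
  the registered 4-stub skeleton `Cruxes/AutToGalCM/Lines/birth.lean`);
* `X₂ = WeakGalToAutCM` — weak direction (B) over CM fields for every datum carrying (A) (NEW item);
* `X₃ = ReciprocityCMtoTR` — reciprocity over CM ⇒ over totally real (VERBATIM item stmt-Langlands-1096).

`X₂` is cut into POTENTIAL AUTOMORPHY over CM fields (`stub_potentialAutomorphyCM`, the
`∀ 𝓡`-given-(A) form — legitimate because `ReciprocityData.pst` is PINNED and ignores `𝓡`; implied by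
item stmt-Langlands-14091, LANDED seam `Theorems.ReciprocityTRCM.stub_potentialAutomorphyCM_of_potentialAutomorphy`,
p172229) and DESCENT OF WEAK AUTOMORPHY along an arbitrary finite Galois extension given (A)
(`stub_descentOfAutomorphy`, VERBATIM item stmt-Langlands-1062); `X₃` is cut into the (A)-transfer
CM ⇒ TR by Sorensen patching (`stub_autToGalCMtoTR`, VERBATIM item stmt-Langlands-1063) and the
weak-(B)-transfer CM ⇒ TR, which since cycle 5 is stub 3 (item 1062) applied at a good CM quadratic
(`Theorems.ReciprocityTRCM.weakGalToAutTR_of_descentOfAutomorphy`; cycles 1–4 derived it instead by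
quadratic base change + Arthur–Clozel cyclic descent + the archimedean clause of strong lifting,
`Theorems.ReciprocityTRCM.weakGalToAutTR_of_reciprocityCM`, p172225). `X₁` stays one stub
(`stub_autToGalCM`, VERBATIM 1059).

## State after cycle 5 (lead prover-line-stmt-Langlands-1093-c4-0): FOUR stubs, all existing items
RESHAPE v7 → v8 (cycle 5): the two trace-formula stubs of v2–v7 — `stub_cuspidalDescent` (= item
stmt-Langlands-18032, Arthur–Clozel Ch. 3 Thm. 4.2 (d)) and `stub_strongLiftingArchimedean` (= the
Literature named fact `ArthurClozel1989_strongLifting_archimedean`, Ch. 3 Thm. 5.1 archimedean clause) —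
are DROPPED.  They served one purpose, the weak direction (B) over a totally real `F` from reciprocity
over CM fields (cyclic descent of the CM avatar `P ↔ ρ|_E` along a good CM quadratic `E/F` + L-algebraicity
of the descended `π` + twist matching; landed as `Theorems.ReciprocityTRCM.weakGalToAutTR_of_reciprocityCM`,
p172225), and that step is an INSTANCE of stub 3 = item stmt-Langlands-1062, which this skeleton carries
verbatim since v1 and which quantifies over every number field `F` and every finite Galois `F'/F`: at a
totally real `F` take `F' := E` the good CM quadratic (`stub_exists_goodCMQuadratic_of_deRhamRestriction`,
p153974, with the discharged `DeRhamBaseChange_holds`, p169021), the L-algebraic cuspidal `P ↔ ρ|_E` from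
(B) over `E`, and descend by 1062 given (A) over `F` (stub 4).  Landed, item-exact and importable
(module `Theorems/BaseFieldAscentReciprocityTRCMOfDescent`, cycle 5):
`Theorems.ReciprocityTRCM.weakGalToAutTR_of_descentOfAutomorphy : <1062> → (RecCM → weak (B) over TR)`,
`Theorems.ReciprocityTRCM.reciprocityCMtoTR_of_descentOfAutomorphy_of_autToGalCMtoTR : <1062> → <1063> → <1096>`,
`Theorems.ReciprocityTRCM.reciprocityTRCM_of_four_stubs : <1059> → <stub 2> → <1062> → <1063> → <crux>` and
`Theorems.ReciprocityTRCM.reciprocityTRCM_of_four_items : <1059> → <14091> → <1062> → <1063> → <crux>`.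
So the crux now rests on FOUR existing ledger items and NO Literature debt inside this skeleton:
1059 (irregular (A) over CM; registered line `Cruxes/AutToGalCM/Lines/birth.lean`), 14091|CM (potential
automorphy over CM; line `Cruxes/PotentialAutomorphy/Lines/birth.lean`), 1062 (descent of weak automorphy;
line `Cruxes/DescentOfAutomorphy/Lines/birth.lean`, whose solvable layer stmt-Langlands-1064 is where
Arthur–Clozel descent and the archimedean clause are consumed), 1063 ((A) CM ⇒ TR; weak sector landed
p151762/p153905/p154581, full form needs canonical reciprocity data over totally real fields, item
stmt-Langlands-17930, and local–global transport along `F_v ≃ E_w`).  The v7 compositions through 18032 +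
AC-arch (`reciprocityTRCM_of_stubs`, `reciprocityTRCM_of_items`, `reciprocityCMtoTR_of_items`, module
`Theorems/BaseFieldAscentReciprocityTRCMOfItems`, p172359) stay in the tree as the alternative glue.

## Lead reshapes (history)
* cycle 1 (prover-line-stmt-Langlands-1093-0): stub 5 DERIVED from 5E/5A1/5A2 + named facts; landed
  p150131, p150371, p151762, p151870, p152952, p153731, p153905, p153974, p154581.
* cycle 2 (…-c1-0): landed stubs IMPORTED; named-facts bundle RE-CUT into `stub_cuspidalDescent` = item
  18032 VERBATIM + `stub_strongLiftingArchimedean` (by name); de Rham restriction RE-CUT into the local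
  named fact `DeRhamBaseChange` + plumbing 5G (p157558); p157223, p157885, p159395, p162079.
* cycle 3 (…-c2-0): `DeRhamBaseChange` DISCHARGED (`DeRhamBaseChange_holds`, p169021, from p165885,
  p166518, p168265, p168596); stub 5L LANDED (p169357); six stubs remain.
* cycle 4 (…-c3-0): compositions LANDED as Theorems (p172225, p172228, p172229, p172359 OfItems);
  seam 14091 ⇒ stub 2 LANDED; skeleton thinned to v7 (stubs + `_Goal` + one-line `ReciprocityTRCM_of`).
* cycle 5 (…-c4-0, this file): the TR weak-(B) step re-derived from stub 3 (item 1062) at `F' =` good CM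
  quadratic (`Theorems/…OfDescent`); stubs F1 (18032) and F2 (AC-arch) DROPPED; v8 = four stubs, all items.

Disproof used: none exists for this crux (`ledger crux ls stmt-Langlands-1093`: no `Disproof.lean`,
no `Negative/`). The paper-refutation of the old `∀ R` potential-automorphy item stmt-Langlands-1060
(permissive prover-chosen `R.pst`) cannot recur: `ReciprocityData.pst` is pinned (D-0018 L2).
-/

set_option linter.dupNamespace false

noncomputable section

namespace Summit.Langlands.Langlands.Cruxes.ReciprocityTRCM.Pieces

open scoped MatrixGroups NumberField Classical
open Summit.Langlands.Langlands.Theses.BaseFieldAscent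
open Filter

/-! ## 1. The stubs -/

/-- **STUB 1 — `X₁`: direction (A) over CM fields, all ranks, all weights** (VERBATIM item
stmt-Langlands-1059 `LiftDescend.AutToGalCM` = `CMFern.AutToGalCM`; plan: registered skeleton
`Cruxes/AutToGalCM/Lines/birth.lean` — Satake existence / irreducibility / `ℓ ≠ p` compatibility /
`ℓ = p` compatibility + de Rham). Regular weight: Harris–Lan–Taylor–Thorne, Scholze (+ Varma, A'Campo,
Caraiani–Newton); OPEN CORE: irregular weight. Why it might fail as typed: an L-algebraic `π` with a
transcendental Satake parameter has no `ρ_{π,ι}` for generic `ι` (Buzzard–Gee Conj. 3.1.5 is forced).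
[cite: HarrisLanTaylorThorneRMS2016, Thm. A] [cite: Scholze2015, Thm. 1.0.4] -/
theorem stub_autToGalCM : ∀ (F : Type) [Field F] [NumberField F], NumberField.IsCMField F → ∃ R : ReciprocityData F, ∀ n : ℕ, 0 < n → ∀ hcpt : Literature.NumberTheory.Automorphic.isCompact_glFiniteIntegralLevel n F, AutomorphicToGalois n R hcpt := by
  sorry

/-- **STUB 2 — potential weak automorphy over CM fields, given (A) for the datum** (first half of the
plan for `X₂`): for a CM field `F` and `𝓡` carrying (A) in every rank, every irreducible geometric
`ρ : Γ_F → GL_n(ℚ̄_ℓ)` (pinned Fontaine datum: `IsGeometricFramed 𝓡 ρ` is `𝓡`-free) becomes weakly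
cuspidal-automorphic (a.e. Satake–Frobenius compatible with an L-algebraic cuspidal `π'`) over SOME
finite Galois extension `F'/F` on which it stays irreducible. Engines: Taylor's potential modularity,
BLGGT Thm. 4.5.1 (regular, polarisable, potentially diagonalisable), ACC+ Thm. 6.1.1 (regular,
decomposed generic, over CM); OPEN for Hodge-irregular `ρ` and residually degenerate `ρ`. Implied by
item stmt-Langlands-14091 (`LiftDescend.PotentialAutomorphy`, `∃ 𝓡`-pinned, all `F`) restricted to
CM fields. Tight: it is implied back by the weak (B) over CM it serves (p151870).
[cite: BarnetlambEtAl2014, Thm. 4.5.1] [cite: ACCGHLNSTT2023, Thm. 6.1.1] -/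
theorem stub_potentialAutomorphyCM : ∀ (F : Type) [Field F] [NumberField F], NumberField.IsCMField F → ∀ R : ReciprocityData F, (∀ n : ℕ, 0 < n → ∀ hcpt : Literature.NumberTheory.Automorphic.isCompact_glFiniteIntegralLevel n F, AutomorphicToGalois n R hcpt) → ∀ (n : ℕ), 0 < n → ∀ (ℓ : ℕ) [Fact ℓ.Prime] (ι : PadicAlgCl ℓ ≃+* ℂ) (ρ : Literature.NumberTheory.GaloisRepresentations.FramedGaloisRep F (PadicAlgCl ℓ) n), ρ.toGaloisRep.IsIrreducible → IsGeometricFramed R ρ → ∃ (F' : Type) (_ : Field F') (_ : NumberField F') (_ : Algebra F F') (_ : IsGalois F F'), (ρ.restrictField F').toGaloisRep.IsIrreducible ∧ ∃ (hcpt' : Literature.NumberTheory.Automorphic.isCompact_glFiniteIntegralLevel n F') (π' : Literature.NumberTheory.Automorphic.CuspidalAutomorphicRepData n F' hcpt'), π'.1.IsLAlgebraic ∧ ∀ᶠ w : IsDedekindDomain.HeightOneSpectrum (NumberField.RingOfIntegers F') in cofinite, SatakeFrobCompatibleAt ι π'.1 (ρ.restrictField F') w := by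
  sorry

/-- **STUB 3 — descent of weak automorphy along an arbitrary finite Galois extension, given (A)**
(second half of the plan for `X₂`; VERBATIM item stmt-Langlands-1062 `LiftDescend.DescentOfAutomorphy`,
which has its own registered skeleton `Cruxes/DescentOfAutomorphy/Lines/birth.lean`): solvable
`Gal(F'/F)` is theorem-level (Arthur–Clozel cyclic descent + (A) + Clifford theory, item
stmt-Langlands-1064), insoluble `Gal(F'/F)` is the open core (non-solvable base-change descent). Used
here at CM `F` (piece `X₂`, arbitrary `F'`) and, since cycle 5, at totally real `F` with `F' =` a good CM
quadratic (the weak (B) over TR of piece `X₃`). [cite: ArthurClozelAMS120, Ch. 3 Thm. 6.2] [cite: BarnetlambEtAl2014, §5] -/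
theorem stub_descentOfAutomorphy : ∀ (F : Type) [Field F] [NumberField F] (R : ReciprocityData F), (∀ n : ℕ, 0 < n → ∀ hcpt : Literature.NumberTheory.Automorphic.isCompact_glFiniteIntegralLevel n F, AutomorphicToGalois n R hcpt) → ∀ (n : ℕ), 0 < n → ∀ (ℓ : ℕ) [Fact ℓ.Prime] (ι : PadicAlgCl ℓ ≃+* ℂ) (ρ : Literature.NumberTheory.GaloisRepresentations.FramedGaloisRep F (PadicAlgCl ℓ) n), ρ.toGaloisRep.IsIrreducible → IsGeometricFramed R ρ → (∃ (F' : Type) (_ : Field F') (_ : NumberField F') (_ : Algebra F F') (_ : IsGalois F F'), (ρ.restrictField F').toGaloisRep.IsIrreducible ∧ ∃ (hcpt' : Literature.NumberTheory.Automorphic.isCompact_glFiniteIntegralLevel n F') (π' : Literature.NumberTheory.Automorphic.CuspidalAutomorphicRepData n F' hcpt'), π'.1.IsLAlgebraic ∧ ∀ᶠ w : IsDedekindDomain.HeightOneSpectrum (NumberField.RingOfIntegers F') in cofinite, SatakeFrobCompatibleAt ι π'.1 (ρ.restrictField F') w) → ∀ hcpt : Literature.NumberTheory.Automorphic.isCompact_glFiniteIntegralLevel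 n F, ∃ π : Literature.NumberTheory.Automorphic.CuspidalAutomorphicRepData n F hcpt, π.1.IsLAlgebraic ∧ ∀ᶠ v : IsDedekindDomain.HeightOneSpectrum (NumberField.RingOfIntegers F) in cofinite, SatakeFrobCompatibleAt ι π.1 ρ v := by
  sorry

/-- **STUB 4 — (A) over all CM fields ⇒ (A) over all totally real fields** (first half of the plan for
`X₃`; VERBATIM item stmt-Langlands-1063 `LiftDescend.AutToGalCMtoTR`): for `π` over a totally real `F`
base-change to the imaginary-quadratic composita `FK_i` (Arthur–Clozel; cuspidal for all but finitely
many `K_i`), take `ρ_i` over `FK_i` from (A), patch with Sorensen's lemma (tree: `PatchingLemma` /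
`SorensenPatching`, proved), transfer local–global compatibility and de Rhamness at `v` from a `K_i`
split at `v`; uniqueness by Chebotarev. Weak (a.e. Satake) sector LANDED (p151762, p153905, p154581);
the full form is blocked on item stmt-Langlands-17930 (`∃ R` over TR fields) and on the transport of
`LocalGlobalCompatibleAt` / pinned de Rham-ness along `F_v ≃+* E_w` (B1/B2).
[cite: Sorensen2020, Thm. 1] [cite: ArthurClozelAMS120, Ch. 3 Thm. 4.2] -/
theorem stub_autToGalCMtoTR : (∀ (F : Type) [Field F] [NumberField F], NumberField.IsCMField F → ∃ R : ReciprocityData F, ∀ n : ℕ, 0 < n → ∀ hcpt : Literature.NumberTheory.Automorphic.isCompact_glFiniteIntegralLevel n F, AutomorphicToGalois n R hcpt) → ∀ (F : Type) [Field F] [NumberField F], NumberField.IsTotallyReal F → ∃ R : ReciprocityData F, ∀ n : ℕ, 0 < n → ∀ hcpt : Literature.NumberTheory.Automorphic.isCompact_glFiniteIntegralLevel n F, AutomorphicToGalois n R hcpt := by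
  sorry

/-! ### Former stub 5E-dR (de Rham restriction of the pinned data): RE-CUT in cycle 2 into the local
named fact `DeRhamBaseChange` (Brinon–Conrad Prop. 6.3.8) + number-field plumbing 5G (p157558); the named
fact DISCHARGED in cycle 3 (`Literature.NumberTheory.PAdicHodge.DeRhamBaseChange_holds`, p169021) and the
stub LANDED under its registered name (`Theorems.ReciprocityTRCM.stub_deRhamBaseChange_local`, p169357);
consumed since cycle 4 inside the landed `Theorems.ReciprocityTRCM.weakGalToAutTR_of_reciprocityCM`. -/

/-! ### Former stubs F1–F2 (Arthur–Clozel cuspidal descent = item stmt-Langlands-18032; the archimedean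
clause of strong lifting = `ArthurClozel1989_strongLifting_archimedean`): DROPPED in cycle 5 — the weak (B)
over totally real fields they produced (`Theorems.ReciprocityTRCM.weakGalToAutTR_of_reciprocityCM`, p172225)
is an instance of stub 3 (item 1062) at `F' =` a good CM quadratic
(`Theorems.ReciprocityTRCM.weakGalToAutTR_of_descentOfAutomorphy`, module `Theorems/…OfDescent`). -/

/-! ## 2. The stub statements as named propositions (literally the stubs' types) -/

namespace _Goal

/-- The statement of `stub_autToGalCM` (literally its type) = piece `X₁ = AutToGalCM` = item
stmt-Langlands-1059. [folklore] -/
def stub_autToGalCM : Prop :=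
  type_of% @Summit.Langlands.Langlands.Cruxes.ReciprocityTRCM.Pieces.stub_autToGalCM

/-- The statement of `stub_potentialAutomorphyCM` (literally its type; implied by item
stmt-Langlands-14091, `Theorems.ReciprocityTRCM.stub_potentialAutomorphyCM_of_potentialAutomorphy`). [folklore] -/
def stub_potentialAutomorphyCM : Prop :=
  type_of% @Summit.Langlands.Langlands.Cruxes.ReciprocityTRCM.Pieces.stub_potentialAutomorphyCM

/-- The statement of `stub_descentOfAutomorphy` (literally its type) = item stmt-Langlands-1062. [folklore] -/
def stub_descentOfAutomorphy : Prop :=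
  type_of% @Summit.Langlands.Langlands.Cruxes.ReciprocityTRCM.Pieces.stub_descentOfAutomorphy

/-- The statement of `stub_autToGalCMtoTR` (literally its type) = item stmt-Langlands-1063. [folklore] -/
def stub_autToGalCMtoTR : Prop :=
  type_of% @Summit.Langlands.Langlands.Cruxes.ReciprocityTRCM.Pieces.stub_autToGalCMtoTR

end _Goal

/-! ## 2a. The identifications stub ≡ item / fact are faithful (kernel-checked) -/

/-- Piece `X₁` is stub 1 = item stmt-Langlands-1059, definitionally. [folklore] -/
theorem stub_autToGalCM_iff : _Goal.stub_autToGalCM ↔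
    (∀ (F : Type) [Field F] [NumberField F], NumberField.IsCMField F → ∃ R : ReciprocityData F,
      ∀ n : ℕ, 0 < n → ∀ hcpt : Literature.NumberTheory.Automorphic.isCompact_glFiniteIntegralLevel n F,
        AutomorphicToGalois n R hcpt) := Iff.rfl

/-- Stub 2 from item stmt-Langlands-14091 (verbatim), through the LANDED seam (p172229). [folklore] -/
theorem stub_potentialAutomorphyCM_of_item
    (h : ∀ (F : Type) [Field F] [NumberField F], (∃ R₀ : ReciprocityData F, ∀ n : ℕ, 0 < n → ∀ hcpt : Literature.NumberTheory.Automorphic.isCompact_glFiniteIntegralLevel n F, AutomorphicToGalois n R₀ hcpt) → ∃ R : ReciprocityData F, (∀ n : ℕ, 0 < n → ∀ hcpt : Literature.NumberTheory.Automorphic.isCompact_glFiniteIntegralLevel n F, AutomorphicToGalois n R hcpt) ∧ ∀ (n : ℕ), 0 < n → ∀ (ℓ : ℕ) [Fact ℓ.Prime] (ι : PadicAlgCl ℓ ≃+* ℂ) (ρ : Literature.NumberTheory.GaloisRepresentations.FramedGaloisRep F (PadicAlgCl ℓ) n), ρ.toGaloisRep.IsIrreducible → IsGeometricFramed R ρ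 → ∃ (F' : Type) (_ : Field F') (_ : NumberField F') (_ : Algebra F F') (_ : IsGalois F F'), (ρ.restrictField F').toGaloisRep.IsIrreducible ∧ ∃ (hcpt' : Literature.NumberTheory.Automorphic.isCompact_glFiniteIntegralLevel n F') (π' : Literature.NumberTheory.Automorphic.CuspidalAutomorphicRepData n F' hcpt'), π'.1.IsLAlgebraic ∧ ∀ᶠ w : IsDedekindDomain.HeightOneSpectrum (NumberField.RingOfIntegers F') in cofinite, SatakeFrobCompatibleAt ι π'.1 (ρ.restrictField F') w) :
    _Goal.stub_potentialAutomorphyCM :=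
  Theorems.ReciprocityTRCM.stub_potentialAutomorphyCM_of_potentialAutomorphy h

/-! ## 3. The crux from the four stubs, BY NAME — one application of the landed composition -/

/-- **`ReciprocityTRCM` from the registered stubs**: the landed item-exact composition
`Theorems.ReciprocityTRCM.reciprocityTRCM_of_four_stubs` (module `Theorems/BaseFieldAscentReciprocityTRCMOfDescent`:
`X₁` = stub 1; `X₂` from stubs 2–3; `X₃` from stub 4 and the weak (B) over totally real fields, itself stub 3
at a good CM quadratic — with the weak-to-strong upgrade `corresponds_of_exists_corresponds` over CM and TR
fields), applied to the stubs; its conclusion (the crux statement verbatim) is the route decl by `δ`.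
[folklore] -/
theorem ReciprocityTRCM_of (h₁ : _Goal.stub_autToGalCM) (h₂ : _Goal.stub_potentialAutomorphyCM)
    (h₃ : _Goal.stub_descentOfAutomorphy) (h₄ : _Goal.stub_autToGalCMtoTR) : ReciprocityTRCM :=
  Theorems.ReciprocityTRCM.reciprocityTRCM_of_four_stubs h₁ h₂ h₃ h₄

/-- **`ReciprocityTRCM` from existing ledger items only** (1059, 14091, 1062, 1063, verbatim), BY NAME: the
form in which the crux closes when its items do. [folklore] -/
theorem ReciprocityTRCM_of_items (h₁ : _Goal.stub_autToGalCM)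
    (h14091 : ∀ (F : Type) [Field F] [NumberField F], (∃ R₀ : ReciprocityData F, ∀ n : ℕ, 0 < n → ∀ hcpt : Literature.NumberTheory.Automorphic.isCompact_glFiniteIntegralLevel n F, AutomorphicToGalois n R₀ hcpt) → ∃ R : ReciprocityData F, (∀ n : ℕ, 0 < n → ∀ hcpt : Literature.NumberTheory.Automorphic.isCompact_glFiniteIntegralLevel n F, AutomorphicToGalois n R hcpt) ∧ ∀ (n : ℕ), 0 < n → ∀ (ℓ : ℕ) [Fact ℓ.Prime] (ι : PadicAlgCl ℓ ≃+* ℂ) (ρ : Literature.NumberTheory.GaloisRepresentations.FramedGaloisRep F (PadicAlgCl ℓ) n), ρ.toGaloisRep.IsIrreducible → IsGeometricFramed R ρ → ∃ (F' : Type) (_ : Field F') (_ : NumberField F') (_ : Algebra F F') (_ : IsGalois F F'), (ρ.restrictField F').toGaloisRep.IsIrreducible ∧ ∃ (hcpt' : Literature.NumberTheory.Automorphic.isCompact_glFiniteIntegralLevel n F') (π' : Literature.NumberTheory.Automorphic.CuspidalAutomorphicRepData n F' hcpt'), π'.1.IsLAlgebraic ∧ ∀ᶠ w : IsDedekindDomain.HeightOneSpectrum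 (NumberField.RingOfIntegers F') in cofinite, SatakeFrobCompatibleAt ι π'.1 (ρ.restrictField F') w)
    (h₃ : _Goal.stub_descentOfAutomorphy) (h₄ : _Goal.stub_autToGalCMtoTR) : ReciprocityTRCM :=
  Theorems.ReciprocityTRCM.reciprocityTRCM_of_four_items h₁ h14091 h₃ h₄

/-- **The route's support item stmt-Langlands-1096 `ReciprocityCMtoTR`, BY NAME, from stubs 3 and 4**
(landed `Theorems.ReciprocityTRCM.reciprocityCMtoTR_of_descentOfAutomorphy_of_autToGalCMtoTR`). [folklore] -/
theorem ReciprocityCMtoTR_of (h₃ : _Goal.stub_descentOfAutomorphy) (h₄ : _Goal.stub_autToGalCMtoTR) :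
    ReciprocityCMtoTR :=
  Theorems.ReciprocityTRCM.reciprocityCMtoTR_of_descentOfAutomorphy_of_autToGalCMtoTR h₃ h₄

/-- By-name sanity check: the four stubs feed the composition as they stand. -/
example : ReciprocityTRCM :=
  ReciprocityTRCM_of stub_autToGalCM stub_potentialAutomorphyCM stub_descentOfAutomorphy stub_autToGalCMtoTR

end Summit.Langlands.Langlands.Cruxes.ReciprocityTRCM.Pieces

end
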